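import Summits.ResolutionOfSingularities.ResolutionOfSingularities.Theorems.EquisingularLiftEquisingularLiftNatDescentStageTransport
import Summits.ResolutionOfSingularities.ResolutionOfSingularities.Theorems.EquisingularLiftEquisingularLiftNatResidueHypDefsE10
import Literature.AlgebraicGeometry.Resolution.BlowupSequencesBaseChange
import Literature.AlgebraicGeometry.Resolution.AlterationsLemma32
import HarnessLib

/-!
# [OURS · L1 W4.5(b) · EL♮(3) · WIDTH TABLE D18 «DESCENT-CERTIFICATE DOOR», engine brick (E4) — THE WHOLE CHAIN] `Descent.chain_of_descTransformOK`
# — along a B-tower `s` with B-smooth centres and B-flat exceptionals, the k-side certificate `DescTransformOK (s.comap ι_k) σ_k Y₀ T` is carried, stage by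
# stage through the model squares, to the O-side chain of `ELNatConclusionO` on `s.comap ι_O` with END regular

res-L1-w45b-stub-4 g16 (STUB WORKER 4; desk ★★ R88-PRE «stub-4 g16: (E4) transform-chain brick»; letters = res-type-027 DefsE10 (`DescCentresSmoothOver`,
`DescTransformOK`, 4-ary form of idea-2 g32 (A1)); per-stage bricks ✓/⊙ `…NatDescentStageTransport`).  Crux EL♮(3) = stmt-ResolutionOfSingularities-20148
(parent EL♮ stmt-…-20038; bookkeeping crux stmt-…-15660).  OURS; NOT a statement of any manuscript ([Hironaka2017] is a candidate under adjudication, nothing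
of it is asserted); AI-written, weaker than expert review.  DEF-FREE; no `sorry`; standard axioms; `--supports stmt-…-20148 --as helper`, counted 0.

WHAT.  ★ `Descent.chain_of_descTransformOK` — by induction on `s : CentreSeq X_B` (any B-scheme `q_B : X_B ⟶ Spec B`), GENERALIZED over the stage: an O-stage
`(X_O, σ', S')` in the `Ch`-chain over `(P, q, Y)` which IS the base change of `X_B` along `Spec O ⟶ Spec B` (`HO`), a k-stage `X_k` with `ι_k : X_k ⟶ X_B`, the
model square `j : X_k ⟶ X_O` over `Spec θ` with `j ≫ ι_O = ι_k`, `j ≫ σ' = σ_k ≫ j₀` (`j₀ : P_k ⟶ P` the special fibre of the base, `Y = j₀ '' Y₀`) and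
`j '' T = S'`; hypotheses `s.ExceptionalFlatOver q_B`, `DescCentresSmoothOver s q_B`, `DescTransformOK (s.comap ι_k) σ_k Y₀ T`.  Conclusion: `Ch` holds at
`((s.comap ι_O).top, (s.comap ι_O).comp ≫ σ', (s.comap ι_O).strictTransform S')` AND the reduced structure on the closure of that last transform is REGULAR.
Step: the descended centre `C_B·𝒪_{X_O}` is smooth over `Spec O` (Literature ✓ `smooth_subschemeι_comap_comp`) hence O-flat and regular (✓ `Scheme.IsRegular.of_smooth`);
`Descent.modelStage'` gives the `Ch`-step, the next model square and the next `j '' T = S'`; `Descent.comp_comapMap_eq` gives the next `j ≫ ι_O = ι_k`;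
Literature ✓ `CentreSeq.ExceptionalFlatOver.tail` gives the next `HO`; base: `Descent.isRegular_reducedTransform_of_model` (E5).  The engine `descDoor_elnat`
(res-L1-w45b-nose-w1 g8) instantiates `X_B := ℙⁿ_B`, `ι_O, ι_k := Proj.map`, `j := Proj.map φ = j₀`, `σ' = σ_k = 𝟙`, `S' = Y`, `T = Y₀ = range ι`, `Ch := Q ∧ Chain`.
[cite: StacksProject, Tags 0805, 056P, 01J3] [cite: Grothendieck1967, Prop. 17.5.8 (iii)] (method; index only).
-/

set_option linter.dupNamespace false -- mandated namespace `Summit.<Summit>.<Problem>` of this single-conjunct summit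

noncomputable section

open CategoryTheory CategoryTheory.Limits AlgebraicGeometry TopologicalSpace Topology
open Literature.AlgebraicGeometry.Resolution
open AlgebraicGeometry.Scheme.IdealSheafData
open Summit.ResolutionOfSingularities.ResolutionOfSingularities.Theses.EquisingularLift.Split
open Summit.ResolutionOfSingularities.ResolutionOfSingularities.Cruxes.EquisingularLift.StrataSplit

namespace Summit.ResolutionOfSingularities.ResolutionOfSingularities.Cruxes.EquisingularLiftNat.Sections

section Chain

variable {B : Type} [CommRing B] (O : Type) [CommRing O] [IsLocalRing O] [IsNoetherianRing O] [Algebra B O]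
  (k : Type) [Field k] (θ : O →+* k) (hθ : Function.Surjective θ)
  (P : Scheme.{0}) (q : P ⟶ Spec (.of O)) (Y : Set P) (hYsp : Y ⊆ q ⁻¹' {IsLocalRing.closedPoint O})
  (Ch : ∀ X' : Scheme.{0}, (X' ⟶ P) → Set X' → Prop)
  (hStep : ∀ (X' X'' : Scheme.{0}) (σ' : X' ⟶ P) (S' : Set X') (C : X'.IdealSheafData) (τ : X'' ⟶ X'),
    Ch X' σ' S' → IsBlowup τ C → Scheme.IsRegular C.subscheme → Flat (C.subschemeι ≫ σ' ≫ q) →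
    σ' '' (C.support : Set X') ⊆ {x : P | ¬ IsGenericPoint x Y} →
    (C.support : Set X') ∩ (σ' ≫ q) ⁻¹' {IsLocalRing.closedPoint O} ⊆ S' →
    Ch X'' (τ ≫ σ') (closure (τ ⁻¹' (S' \ (C.support : Set X')))))
  (hOreg : Scheme.IsRegular (Spec (.of O)))
  {Pk : Scheme.{0}} (j₀ : Pk ⟶ P) [IsClosedImmersion j₀] (Y₀ : Set Pk) (hY : j₀ '' Y₀ = Y)

include hθ hYsp hStep hOreg hY

/-- ★ **(E4, the chain) `Descent.chain_of_descTransformOK`** — see the module docstring: the k-side certificate `DescTransformOK (s.comap ι_k) σ_k Y₀ T` of a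
B-tower `s` with B-smooth centres and B-flat exceptionals yields the O-side `ELNatConclusionO` chain on `s.comap ι_O` — `Ch` at the top with the iterated strict
transform of `S' = j '' T` — and a REGULAR reduced last transform. [cite: StacksProject, Tags 0805, 056P, 01J3] [cite: Grothendieck1967, Prop. 17.5.8 (iii)]
[OURS · L1 W4.5b · D18 engine (E4)]; NOT a statement of the manuscript. -/
theorem Descent.chain_of_descTransformOK :
    ∀ {XB : Scheme.{0}} (s : CentreSeq XB) (qB : XB ⟶ Spec (.of B))
      {XO : Scheme.{0}} (ιO : XO ⟶ XB) (σ' : XO ⟶ P) (S' : Set XO), Ch XO σ' S' → IsLocallyNoetherian XO → Scheme.IsRegular XO →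
      IsPullback ιO (σ' ≫ q) qB (specOfAlgebra B O) →
      ∀ {Xk : Scheme.{0}} (ιk : Xk ⟶ XB) (j : Xk ⟶ XO) (t : Xk ⟶ Spec (.of k)), j ≫ ιO = ιk →
      IsPullback j t (σ' ≫ q) (Spec.map (CommRingCat.ofHom θ)) →
      ∀ (σk : Xk ⟶ Pk), j ≫ σ' = σk ≫ j₀ → ∀ (T : Set Xk), j '' T = S' →
      s.ExceptionalFlatOver qB → DescCentresSmoothOver s qB → DescTransformOK (s.comap ιk) σk Y₀ T →
      Ch (s.comap ιO).top ((s.comap ιO).comp ≫ σ') ((s.comap ιO).strictTransform S') ∧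
        Scheme.IsRegular (vanishingIdeal (⟨closure ((s.comap ιO).strictTransform S'), isClosed_closure⟩ : Closeds (s.comap ιO).top)).subscheme
  | XB, .nil _, qB, XO, ιO, σ', S', hCh, _, _, _, Xk, ιk, j, t, _, hsq, σk, _, T, hTS, _, _, hT => by
    haveI : IsClosedImmersion (Spec.map (CommRingCat.ofHom θ)) := IsClosedImmersion.spec_of_surjective _ hθ
    haveI : IsClosedImmersion j := MorphismProperty.IsStableUnderBaseChange.of_isPullback hsq.flip inferInstance
    refine ⟨by simpa only [CentreSeq.comap_nil, CentreSeq.top_nil, CentreSeq.comp_nil, Category.id_comp, CentreSeq.strictTransform_nil] using hCh, ?_⟩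
    simp only [CentreSeq.comap_nil, CentreSeq.top_nil, CentreSeq.strictTransform_nil]
    exact Descent.isRegular_reducedTransform_of_model j T S' hTS hT
  | XB, .cons CB rest, qB, XO, ιO, σ', S', hCh, hnoeth, hreg, HO, Xk, ιk, j, t, hj, hsq, σk, hcomm, T, hTS, hflat, hsm, hT => by
    haveI := hnoeth
    -- the descended centre over `O`: smooth over `Spec O` (base change of the B-smooth centre), hence O-flat and regular
    haveI : Smooth (CB.subschemeι ≫ qB) := hsm.1
    haveI hsmO : Smooth ((CB.comap ιO).subschemeι ≫ σ' ≫ q) := smooth_subschemeι_comap_comp O qB CB HO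
    have hCflat : Flat ((CB.comap ιO).subschemeι ≫ σ' ≫ q) := inferInstance
    have hCreg : Scheme.IsRegular (CB.comap ιO).subscheme := Scheme.IsRegular.of_smooth ((CB.comap ιO).subschemeι ≫ σ' ≫ q) hOreg
    -- the descended centres match along `j`
    have hCD : (CB.comap ιO).comap j = CB.comap ιk := Descent.comap_comap_eq ιO ιk j hj CB
    -- the k-side tokens at this stage
    obtain ⟨hDT, hDgen, hT'⟩ := hT
    -- one descended stage
    obtain ⟨hCh', hreg', hnoeth', j₂, t₂, hsq₂, hcomm₂, hsets, hcomm'⟩ :=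
      Descent.modelStage' O k θ hθ P q Y hYsp Ch hStep XO σ' S' hCh hreg Xk j t hsq T hTS j₀ σk hcomm Y₀ hY (CB.comap ιO) (CB.comap ιk) hCD
        hCreg hCflat hDT hDgen (blowup (CB.comap ιO)) (blowup.π (CB.comap ιO)) (blowup.isBlowup _) (blowup (CB.comap ιk)) (blowup.π (CB.comap ιk))
        (blowup.isBlowup _)
    -- the next O-stage is again the base change of the next B-stage (B-flat exceptional)
    obtain ⟨hflat', HO'⟩ := CentreSeq.ExceptionalFlatOver.tail O hflat HO
    have HO'' : IsPullback (blowup.comapMap CB ιO) ((blowup.π (CB.comap ιO) ≫ σ') ≫ q) (blowup.π CB ≫ qB) (specOfAlgebra B O) := by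
      rw [Category.assoc]; exact HO'
    -- the comparison map is the canonical one
    have hj' : j₂ ≫ blowup.comapMap CB ιO = blowup.comapMap CB ιk := Descent.comp_comapMap_eq ιO ιk j hj CB j₂ hcomm₂
    -- recurse
    have ih := Descent.chain_of_descTransformOK rest (blowup.π CB ≫ qB) (blowup.comapMap CB ιO) (blowup.π (CB.comap ιO) ≫ σ')
      (closure (blowup.π (CB.comap ιO) ⁻¹' (S' \ ((CB.comap ιO).support : Set XO)))) hCh' hnoeth' hreg' HO''
      (blowup.comapMap CB ιk) j₂ t₂ hj' hsq₂ (blowup.π (CB.comap ιk) ≫ σk) hcomm' _ hsets hflat' hsm.2 hT'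
    obtain ⟨ih1, ih2⟩ := ih
    refine ⟨?_, ih2⟩
    show Ch _ (((rest.comap (blowup.comapMap CB ιO)).comp ≫ blowup.π (CB.comap ιO)) ≫ σ') _
    rw [Category.assoc]
    exact ih1

end Chain

end Summit.ResolutionOfSingularities.ResolutionOfSingularities.Cruxes.EquisingularLiftNat.Sections

end
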